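import Mathlib
import HarnessLib
import Summits.HubbardSuperconductivity.HubbardSuperconductivity.Theorems.ComplexGFFStiffnessHypACumulantWeightSeed
import Summits.HubbardSuperconductivity.HubbardSuperconductivity.Theorems.ComplexGFFStiffnessHypACumulantGreenSplit
import Literature.MathematicalPhysics.StatisticalMechanics.TorusMultiplierKernels

/-!
# Line `gnv`, stub `stub_gnvOfFrd`: the lattice Laplacian and the seed as multiplier matrices
# (ABKM19 Remark 7.4 / (7.42) for the model on `(ℤ/n)^4`)

The abstract Chapter-7 machinery (`GradientRG.WeightData.dominated_of_multipliers`,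
`seed_le_of_multipliers`, `h73_of_shellBoundsV`) is phrased with Fourier-multiplier matrices
`GradientFRD.mulMat`.  This file supplies the two model-specific identifications at scale `0`:

* `lapMat_eq_mulMat` — `−Δ_Λ = mulMat (symbR 1)` (the symbol `â(κ) = |q(κ)|²` of the free action);
* `dirichletForm_le_mulMat_half_symbR` — `dirichletForm n X ⪯ mulMat (â/2)`, the gradient part of the
  hypothesis `hseed` of `seed_le_of_multipliers` (ABKM19 (7.42) with `1 − 4θ̄ = ½`);
* `symbR_one_eq_qnormSq` — `â = |q|²` for the identity coefficient matrix.
-/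

noncomputable section

-- `Summit.<Summit>.<Problem>`: single-conjunct summit, the duplicate component is mandated (D-0017).
set_option linter.dupNamespace false

namespace Summit.HubbardSuperconductivity.HubbardSuperconductivity.Theorems.ComplexGFF

open Finset Matrix
open Literature.MathematicalPhysics.StatisticalMechanics.GradientFRD
  (mulMat symbR qnormSq qmode ellOp_eq_mulMat_mulVec mulMat_smul)

variable {n : ℕ} [NeZero n]

/-- Two matrices with the same action coincide. -/
private theorem matrix_eq_of_mulVec_eq {A B : Matrix (Fin 4 → ZMod n) (Fin 4 → ZMod n) ℝ}
    (h : ∀ φ, A *ᵥ φ = B *ᵥ φ) : A = B := by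
  ext i j
  have := congrFun (h (Pi.single j 1)) i
  simpa [Matrix.mulVec_single_one] using this

/-- **`−Δ_Λ = mulMat (symbR 1)`**: the forward-gradient Laplacian of the line is the multiplier matrix
of the symbol `â(κ) = Σ_j |q_j(κ)|²` (ABKM19 Remark 7.4). -/
theorem lapMat_eq_mulMat : lapMat n = mulMat (symbR (1 : Matrix (Fin 4) (Fin 4) ℝ)) := by
  refine matrix_eq_of_mulVec_eq fun φ => ?_
  rw [← ellOp_one_eq_lapMat_mulVec, ellOp_eq_mulMat_mulVec Matrix.isSymm_one]

/-- `â(κ) = |q(κ)|²` for the identity coefficient matrix. -/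
theorem symbR_one_eq_qnormSq (κ : Fin 4 → ZMod n) :
    symbR (1 : Matrix (Fin 4) (Fin 4) ℝ) κ = qnormSq κ := by
  unfold symbR qnormSq
  rw [Finset.sum_comm]
  refine sum_congr rfl fun j _ => ?_
  rw [Finset.sum_eq_single j (fun i _ hij => by rw [Matrix.one_apply_ne hij, zero_mul])
    (fun h => (h (mem_univ j)).elim), Matrix.one_apply_eq, one_mul, Complex.sq_norm, Complex.normSq_apply]

/-- **The seed's gradient part in multiplier form** (ABKM19 (7.42) with `1 − 4θ̄ = ½`):
`dirichletForm n X ⪯ mulMat (â/2)`. -/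
theorem dirichletForm_le_mulMat_half_symbR (X : Finset (Fin 4 → ZMod n)) :
    (mulMat (fun κ => symbR (1 : Matrix (Fin 4) (Fin 4) ℝ) κ / 2) - dirichletForm n X).PosSemidef := by
  have h : mulMat (fun κ => symbR (1 : Matrix (Fin 4) (Fin 4) ℝ) κ / 2) = (1 / 2 : ℝ) • lapMat n := by
    rw [lapMat_eq_mulMat, ← mulMat_smul]
    congr 1; funext κ; ring
  rw [h]
  exact half_lapMat_sub_dirichletForm_posSemidef X

end Summit.HubbardSuperconductivity.HubbardSuperconductivity.Theorems.ComplexGFF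

end
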